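import Summits.CriticalPhenomena.PercolationContinuityZ3.Theorems.PercNearOneGluingNoHeavyLowerTailWorstPairExchange
import HarnessLib

/-!
# `NoHeavyLowerTail` (stmt-CriticalPhenomena-4575) — WORST-FIRST GLUING: a k-relay inequality (conjectural for
# `|A| ≥ 3`, proved here for `|A| ≤ 2`) that closes event gluing, `AdditiveGluing` (stmt-4576) and `NoHeavyLowerTail`

Support file (prover prim-gen-kcluster gen 2, k-cluster conditional-association line; `--supports stmt-CriticalPhenomena-4575`).
No definitions, no named facts, no sorries.

Setting: `μ = prodBernoulli w` on `Fin n`, observer `o`, sink `c`, finite relay set `A`, `d_x := μ(x ↮ c)`.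
Rank the relays WORST FIRST: `x` precedes `a` iff `d_x > d_a`, or `d_x = d_a` and `x < a` (index tie-break).
For `a ∈ A` the WORST-FIRST EVENT is

  `W_a := {o ↔ a} ∩ {o ↮ c} ∩ ⋂_{x ∈ A, x precedes a} {o ↮ x}`   ("`a` is the worst-ranked relay of `o`'s pocket"),

so that the exit event `{o ↮ c} ∩ ⋃_{a∈A} {o ↔ a}` is the DISJOINT union of the `W_a` (`exit_eq_sum_rank`, any ranking).

WORST-FIRST GLUING (WF):   `Σ_{a ∈ A} μ(W_a) / d_a ≤ 1`,   i.e.  `E[ 1{o ↔ A, o ↮ c} / max_{a ∈ C(o) ∩ A} d_a ] ≤ 1`.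

* `eventGluing_of_worstFirst`: (WF) for all relay sets ⇒ EVENT GLUING `μ({o ↮ c} ∩ ⋃_{a∈A}{o ↔ a}) ≤ max_a d_a`
  for all relay sets (one line: `μ(W_a) = d_a · (μ(W_a)/d_a) ≤ (max d) · (μ(W_a)/d_a)`), hence
  `additiveGluing_of_worstFirst` (stmt-4576) and `noHeavyLowerTail_of_worstFirst` (stmt-4575) by the landed glue.
* (companion file `…WorstFirstGluingTwo.lean`) `worstFirst_two_mul`, `worstFirst_card_le_two`: (WF) HOLDS for `|A| ≤ 2`
  (tripod exchange C⁺ + event gluing for two relays: `d_2 T_1 − d_1 S_1 = (T_1T_2 − S_1S_2) + J(T_1 − S_1) ≥ 0`).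
The seat's census (0 violations in > 4·10⁵ exact instances, `|A| ≤ 6`, `n ≤ 9`; sup = 1 only on degenerate loci) is in its notes;
the nearest-first and the un-normalised chain versions are false, and (WF) is strictly stronger than event gluing when the `d_a` differ.
-/

noncomputable section

namespace Summit.CriticalPhenomena.PercolationContinuityZ3.Theorems

open MeasureTheory Set Literature.Probability.LatticeModels Literature.Probability.Percolation
open Summit.CriticalPhenomena.PercolationContinuityZ3.Theses.PercNearOneGluing
open scoped Classical BigOperators

namespace WorstFirstGluing

variable {n : ℕ}

/-- The worst-first events of two distinct relays are disjoint (for any ranking function `r`). [this file] -/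
theorem rank_event_disjoint (A : Finset (Fin n)) (o c : Fin n) (r : Fin n → ℝ) {a a' : Fin n}
    (ha : a ∈ A) (ha' : a' ∈ A) (hne : a ≠ a') :
    Disjoint
      {ω : BondConfig (Fin n) | (openGraph ω).Reachable o a ∧ ¬ (openGraph ω).Reachable o c ∧
        ∀ x ∈ A, (openGraph ω).Reachable o x → (r x < r a ∨ (r x = r a ∧ a ≤ x))}
      {ω : BondConfig (Fin n) | (openGraph ω).Reachable o a' ∧ ¬ (openGraph ω).Reachable o c ∧
        ∀ x ∈ A, (openGraph ω).Reachable o x → (r x < r a' ∨ (r x = r a' ∧ a' ≤ x))} := by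
  rw [Set.disjoint_left]
  rintro ω ⟨hoa, _, hmax⟩ ⟨hoa', _, hmax'⟩
  rcases hmax a' ha' hoa' with h1 | ⟨h1, h1'⟩
  · rcases hmax' a ha hoa with h2 | ⟨h2, _⟩
    · exact absurd (lt_trans h1 h2) (lt_irrefl _)
    · rw [h2] at h1; exact absurd h1 (lt_irrefl _)
  · rcases hmax' a ha hoa with h2 | ⟨_, h2'⟩
    · rw [h1] at h2; exact absurd h2 (lt_irrefl _)
    · exact hne (le_antisymm h1' h2')

/-- Every nonempty finite set of relays has a worst-ranked element (max of `r`, ties broken by the index).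
[folklore] -/
theorem exists_rank_max (P : Finset (Fin n)) (hP : P.Nonempty) (r : Fin n → ℝ) :
    ∃ a ∈ P, ∀ x ∈ P, r x < r a ∨ (r x = r a ∧ a ≤ x) := by
  obtain ⟨m, hmP, hm⟩ := Finset.exists_max_image P r hP
  set M : Finset (Fin n) := P.filter (fun x => r x = r m) with hM
  have hMne : M.Nonempty := ⟨m, Finset.mem_filter.2 ⟨hmP, rfl⟩⟩
  refine ⟨M.min' hMne, (Finset.mem_filter.1 (Finset.min'_mem M hMne)).1, ?_⟩
  have hra : r (M.min' hMne) = r m := (Finset.mem_filter.1 (Finset.min'_mem M hMne)).2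
  intro x hx
  rcases lt_or_eq_of_le (hm x hx) with hlt | heq
  · left; rw [hra]; exact hlt
  · right
    refine ⟨by rw [hra, heq], ?_⟩
    exact Finset.min'_le M x (Finset.mem_filter.2 ⟨hx, heq⟩)

/-- **Exit decomposition by the worst-ranked pocket relay** (any ranking `r`):
`μ({o ↮ c} ∩ ⋃_{a∈A}{o ↔ a}) = Σ_{a∈A} μ(W_a)`. [this file] -/
theorem exit_eq_sum_rank (w : Sym2 (Fin n) → unitInterval) (A : Finset (Fin n)) (o c : Fin n) (r : Fin n → ℝ) :
    (prodBernoulli w).real ((openConn o c : Set (BondConfig (Fin n)))ᶜ ∩ ⋃ a ∈ A, openConn o a) =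
      ∑ a ∈ A, (prodBernoulli w).real
        {ω : BondConfig (Fin n) | (openGraph ω).Reachable o a ∧ ¬ (openGraph ω).Reachable o c ∧
          ∀ x ∈ A, (openGraph ω).Reachable o x → (r x < r a ∨ (r x = r a ∧ a ≤ x))} := by
  rw [← measureReal_biUnion_finset ?_ (fun _ _ => MeasurableSet.of_discrete)]
  · congr 1
    ext ω
    simp only [mem_inter_iff, mem_compl_iff, mem_iUnion, exists_prop, mem_setOf_eq]
    constructor
    · rintro ⟨hoc, a, haA, hoa⟩
      set P : Finset (Fin n) := A.filter (fun x => (openGraph ω).Reachable o x) with hP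
      have hPne : P.Nonempty := ⟨a, Finset.mem_filter.2 ⟨haA, hoa⟩⟩
      obtain ⟨m, hmP, hm⟩ := exists_rank_max P hPne r
      refine ⟨m, (Finset.mem_filter.1 hmP).1, (Finset.mem_filter.1 hmP).2, hoc, ?_⟩
      intro x hx hox
      exact hm x (Finset.mem_filter.2 ⟨hx, hox⟩)
    · rintro ⟨a, haA, hoa, hoc, _⟩
      exact ⟨hoc, a, haA, hoa⟩
  · intro a ha a' ha' hne
    exact rank_event_disjoint A o c r ha ha' hne

/-- Each worst-first event forces `a ↮ c`: `W_a ⊆ {a ↮ c}`. [folklore] -/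
theorem rank_event_subset (A : Finset (Fin n)) (o c a : Fin n) (r : Fin n → ℝ) :
    {ω : BondConfig (Fin n) | (openGraph ω).Reachable o a ∧ ¬ (openGraph ω).Reachable o c ∧
        ∀ x ∈ A, (openGraph ω).Reachable o x → (r x < r a ∨ (r x = r a ∧ a ≤ x))} ⊆
      (openConn a c : Set (BondConfig (Fin n)))ᶜ := by
  rintro ω ⟨hoa, hoc, _⟩ hac
  exact hoc (SimpleGraph.Reachable.trans hoa hac)

/-- Termwise bookkeeping: if `d_a ≤ s` then `μ(W_a) ≤ s · (μ(W_a) / d_a)` (also when `d_a = 0`, since then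
`μ(W_a) = 0`). [folklore] -/
theorem term_le (w : Sym2 (Fin n) → unitInterval) (A : Finset (Fin n)) (o c a : Fin n) (r : Fin n → ℝ) (s : ℝ)
    (hda : (prodBernoulli w).real (openConn a c : Set (BondConfig (Fin n)))ᶜ ≤ s) :
    (prodBernoulli w).real
        {ω : BondConfig (Fin n) | (openGraph ω).Reachable o a ∧ ¬ (openGraph ω).Reachable o c ∧
          ∀ x ∈ A, (openGraph ω).Reachable o x → (r x < r a ∨ (r x = r a ∧ a ≤ x))} ≤
      s * ((prodBernoulli w).real
        {ω : BondConfig (Fin n) | (openGraph ω).Reachable o a ∧ ¬ (openGraph ω).Reachable o c ∧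
          ∀ x ∈ A, (openGraph ω).Reachable o x → (r x < r a ∨ (r x = r a ∧ a ≤ x))} /
        (prodBernoulli w).real (openConn a c : Set (BondConfig (Fin n)))ᶜ) := by
  set μ := prodBernoulli w with hμ
  set W := μ.real {ω : BondConfig (Fin n) | (openGraph ω).Reachable o a ∧ ¬ (openGraph ω).Reachable o c ∧
          ∀ x ∈ A, (openGraph ω).Reachable o x → (r x < r a ∨ (r x = r a ∧ a ≤ x))} with hW
  set d := μ.real (openConn a c : Set (BondConfig (Fin n)))ᶜ with hd
  have hWd : W ≤ d := measureReal_mono (rank_event_subset A o c a r)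
  have hW0 : 0 ≤ W := measureReal_nonneg
  rcases eq_or_lt_of_le (measureReal_nonneg : 0 ≤ d) with hd0 | hdpos
  · have : W = 0 := le_antisymm (by rw [hd0]; exact hWd) hW0
    rw [this]; simp
  · rw [mul_div_assoc']
    rw [le_div_iff₀ hdpos]
    calc W * d ≤ W * s := mul_le_mul_of_nonneg_left hda hW0
      _ = s * W := mul_comm _ _

end WorstFirstGluing

open WorstFirstGluing WorstPairExchange

/-- **Worst-first gluing ⇒ event gluing (all relay sets).**  Hypothesis (verbatim the conjecture WF, index tie-break):
for every finite weighted graph, observer `o`, sink `c` and relay set `A`,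
`Σ_{a ∈ A} μ(W_a) / μ(a ↮ c) ≤ 1`, where `W_a = {o ↔ a, o ↮ c, and every relay x ∈ A with o ↔ x has
(d_x < d_a or (d_x = d_a and a ≤ x))}` (`a` is the worst-ranked relay of `o`'s pocket).  Conclusion: event gluing
`μ({o ↮ c} ∩ ⋃_{a∈A}{o ↔ a}) ≤ s` whenever `μ(a ↮ c) ≤ s` on `A`. [this file] -/
theorem eventGluing_of_worstFirst
    (hWF : ∀ (n : ℕ) (w : Sym2 (Fin n) → unitInterval) (A : Finset (Fin n)) (o c : Fin n),
      ∑ a ∈ A, (prodBernoulli w).real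
          {ω : BondConfig (Fin n) | (openGraph ω).Reachable o a ∧ ¬ (openGraph ω).Reachable o c ∧
            ∀ x ∈ A, (openGraph ω).Reachable o x →
              ((prodBernoulli w).real (openConn x c : Set (BondConfig (Fin n)))ᶜ <
                  (prodBernoulli w).real (openConn a c : Set (BondConfig (Fin n)))ᶜ ∨
               ((prodBernoulli w).real (openConn x c : Set (BondConfig (Fin n)))ᶜ =
                  (prodBernoulli w).real (openConn a c : Set (BondConfig (Fin n)))ᶜ ∧ a ≤ x))} /
        (prodBernoulli w).real (openConn a c : Set (BondConfig (Fin n)))ᶜ ≤ 1) :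
    ∀ (n : ℕ) (w : Sym2 (Fin n) → unitInterval) (A : Finset (Fin n)) (o c : Fin n) (s : ℝ), 0 ≤ s →
      (∀ a ∈ A, (prodBernoulli w).real (openConn a c : Set (BondConfig (Fin n)))ᶜ ≤ s) →
      (prodBernoulli w).real ((openConn o c : Set (BondConfig (Fin n)))ᶜ ∩ ⋃ a ∈ A, openConn o a) ≤ s := by
  intro n w A o c s hs hcut
  have h := hWF n w A o c
  rw [exit_eq_sum_rank w A o c (fun x => (prodBernoulli w).real (openConn x c : Set (BondConfig (Fin n)))ᶜ)]
  refine le_trans (Finset.sum_le_sum fun a ha => term_le w A o c a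
    (fun x => (prodBernoulli w).real (openConn x c : Set (BondConfig (Fin n)))ᶜ) s (hcut a ha)) ?_
  rw [← Finset.mul_sum]
  calc s * _ ≤ s * 1 := mul_le_mul_of_nonneg_left h hs
    _ = s := mul_one s

/-- **Worst-first gluing ⇒ `AdditiveGluing`** (stmt-CriticalPhenomena-4576). [this file] -/
theorem additiveGluing_of_worstFirst
    (hWF : ∀ (n : ℕ) (w : Sym2 (Fin n) → unitInterval) (A : Finset (Fin n)) (o c : Fin n),
      ∑ a ∈ A, (prodBernoulli w).real
          {ω : BondConfig (Fin n) | (openGraph ω).Reachable o a ∧ ¬ (openGraph ω).Reachable o c ∧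
            ∀ x ∈ A, (openGraph ω).Reachable o x →
              ((prodBernoulli w).real (openConn x c : Set (BondConfig (Fin n)))ᶜ <
                  (prodBernoulli w).real (openConn a c : Set (BondConfig (Fin n)))ᶜ ∨
               ((prodBernoulli w).real (openConn x c : Set (BondConfig (Fin n)))ᶜ =
                  (prodBernoulli w).real (openConn a c : Set (BondConfig (Fin n)))ᶜ ∧ a ≤ x))} /
        (prodBernoulli w).real (openConn a c : Set (BondConfig (Fin n)))ᶜ ≤ 1) :
    Summit.CriticalPhenomena.PercolationContinuityZ3.Theses.PercNearOneGluing.AdditiveGluing :=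
  additiveGluing_of_eventGluing (eventGluing_of_worstFirst hWF)

/-- **Worst-first gluing ⇒ `NoHeavyLowerTail`** (stmt-CriticalPhenomena-4575), through the landed glue
`event gluing ⇒ AdditiveGluing ⇒ NearOneGluing ⇒ residual ⇒ crux`. [this file] -/
theorem noHeavyLowerTail_of_worstFirst
    (hWF : ∀ (n : ℕ) (w : Sym2 (Fin n) → unitInterval) (A : Finset (Fin n)) (o c : Fin n),
      ∑ a ∈ A, (prodBernoulli w).real
          {ω : BondConfig (Fin n) | (openGraph ω).Reachable o a ∧ ¬ (openGraph ω).Reachable o c ∧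
            ∀ x ∈ A, (openGraph ω).Reachable o x →
              ((prodBernoulli w).real (openConn x c : Set (BondConfig (Fin n)))ᶜ <
                  (prodBernoulli w).real (openConn a c : Set (BondConfig (Fin n)))ᶜ ∨
               ((prodBernoulli w).real (openConn x c : Set (BondConfig (Fin n)))ᶜ =
                  (prodBernoulli w).real (openConn a c : Set (BondConfig (Fin n)))ᶜ ∧ a ≤ x))} /
        (prodBernoulli w).real (openConn a c : Set (BondConfig (Fin n)))ᶜ ≤ 1) :
    Summit.CriticalPhenomena.PercolationContinuityZ3.Theses.PercNearOneGluing.NoHeavyLowerTail :=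
  noHeavyLowerTail_of_eventGluing (eventGluing_of_worstFirst hWF)

end Summit.CriticalPhenomena.PercolationContinuityZ3.Theorems

end
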